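import Summits.QuantumFields.BalabanUV.Beta.GAN24.SourceSideBound

/-!
# `BalabanUV.Beta.GAN24.SourceSideRate` — binder row G-an2-4 / (CONV-C), road P1-fibre, sub-part **PART S** of gan24-p1's row
# **P1-L11** `FibreRate` (leaf-20-g7's division, CLAIMS l.3039; TAKE l.3074) — PART 4: the TWO-LEVEL RATE of `S_c` in units `N³`
# (`θ = Lc⁻²` per step; pole `1/|q|` displayed, nonzero aliases `p`-free), plus the label-level two-scale facts shared with part 5

NOT IN PRINT; OUR PROOF ATTEMPT.  HONEST FRAMING (cell contract, verbatim): «discharging `BetaPertH` makes Bałaban's UV stability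
UNCONDITIONAL — a real constructive-QFT result; it is NOT the continuum limit and NOT the Clay problem.»  HONEST DEPENDENCY (verbatim):
«continuum YM on T⁴ ⇐ BetaPertH ∧ nine spine estimates (0/9 proved); BetaPertH ⇐ (D1) ∧ (D4) ∧ CAP+tail; G-an2-4 gates asym, D1 and
NE2/3/4.»  [folklore] explicit real analysis (finite alias sums, matched labels + tail over the nested alias boxes of leaf P1-Y11s); 0 cite,
0 wall binder, no `def … : Prop`; two displayed rate constants (`rcPole`, `rcBox`) as `def`s.  It discharges NOTHING of (CONV-C)'s K-slot
`GAN24.CombesThomas.ConvCK 3 Lc` by itself.  NOT `BetaPertH`, NOT continuum, NOT Clay.  Value = kernel bookkeeping toward the K-slot route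
P1 of binder row G-an2-4, NOT summit progress.

## What is proved (`q ∈ [−π, π]^D ∖ {0}`, `p = ofRealVec q`, two steps `N = M·Lc ≤ N′ = M′·Lc`, same `Lc`; `|q|² = momSq q`)
* §1 label-level two-scale facts at a label `Q = q + 2πz` of the level-`N` box: the scaled inverse symbol at both levels
  (`(symN)⁻¹ ≤ (π²/4)/|Q|²`), its two-level rate `|symN_{N′}⁻¹ − symN_N⁻¹| ≤ (π²/24)/N²` (`ReadingWeightRates.abs_inv_lat_sub_inv_lat_le`
  BY NAME) and the squared form `|symN_{N′}⁻² − symN_N⁻²| ≤ (π⁴/48)/(N²|Q|²)`; the zero-alias form of the paired-product rate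
  `‖Π P_{N′}(q_i) − Π P_N(q_i)‖ ≤ (π²/24)|q|²/N²` (the `|q|²` that cancels the pole); the direction-borrowing bound
  `(Σ_i Π_{j≠i} mP_j)·x ≤ D·Π_j mP_j` for `x ≤ mP_i ∀ i`;
* §2 **`norm_termC_sub_le`** (matched labels): `‖termC_{N′}(Q) − termC_N(Q)‖ ≤ [z = 0]·(π⁶/384 + π⁴/48)/(N²·|q|) +
  ((D·π²·Lc² + 2π²·Lc)/48)/N² · Π_i mP Lc z_i`; **`norm_termC_tail_le`** (labels of `boxZ N′ q ∖ boxZ N q`, `|Q|² ≥ π²N²`):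
  `‖termC_{N′}(Q)‖ ≤ (Lc/8)/N² · Π_i mP Lc z_i`;
* §3 **`srcC_rate`**: `‖srcC N′ p (fhatF N′ M′ p l y′)/N′³ − srcC N p (fhatF N M p l y′)/N³‖ ≤ (rcPole/|q| + rcBox D Lc)/N²`,
  `rcPole = π⁶/384 + π⁴/48`, `rcBox D Lc = ((D·π²·Lc² + 2π²·Lc)/48 + Lc/8)·(1 + 4Lc)^D` — with `N = Lc^{j+1}` this is `c·θ^j`, `θ = Lc⁻²`,
  the shape leaf-20-g7 asked for (unit `u(N) = N⁻³`, `p`-order `|q|⁻¹` in the rate, displayed).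
The `S_φ` rate (p-UNIFORM) is parts 5–6 (`SourceSideRatePhi`, `SourceSideRatePhiSum`).

Unit `b2b-balaban-gan24-formalise-leaf-07` (G-an2-4 formalisation swarm, leaf prover 07, gen 6), 2026-08-20.
-/

noncomputable section

open Complex Finset
open scoped BigOperators Real

namespace Summit.QuantumFields.BalabanUV.Beta.GAN24.SourceSideRate

open Literature.Probability.LatticeModels (TorusSite)
open Literature.MathematicalPhysics.QuantumFieldTheory.Balaban1983to89.B4Strip (ofRealVec)
open Literature.MathematicalPhysics.QuantumFieldTheory.King1986 (momSq momSq_nonneg)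
open FibreSymbols (dhat dflat lapSym)
open CapacitanceScalarRate CapacitanceScalarRateTerm CapacitanceScalarRateBox CapacitanceScalarRateSum
open SourceSidePair SourceSideMajorant SourceSideDict SourceSideBound
open AliasObjects (srcPhi srcC fhatF)

variable {D : ℕ}

/-! ## §1 Label-level two-scale facts -/

/-- [folklore] `‖a·x − b·y‖ ≤ ‖a − b‖·x + ‖b‖·|x − y|` for complex `a, b` and real `x ≥ 0`, `y`. -/
theorem norm_mul_real_sub_le (a b : ℂ) {x : ℝ} (y : ℝ) (hx : 0 ≤ x) :
    ‖a * (x : ℂ) - b * (y : ℂ)‖ ≤ ‖a - b‖ * x + ‖b‖ * |x - y| := by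
  have e : a * (x : ℂ) - b * (y : ℂ) = (a - b) * (x : ℂ) + b * ((x : ℂ) - (y : ℂ)) := by ring
  rw [e]
  refine (norm_add_le _ _).trans (le_of_eq ?_)
  rw [norm_mul, norm_mul, Complex.norm_real, Real.norm_eq_abs, abs_of_nonneg hx, ← Complex.ofReal_sub, Complex.norm_real,
    Real.norm_eq_abs]

/-- [folklore] DIRECTION BORROWING: if `x ≤ mP Lc z_i` for every `i` then `(Σ_i Π_{j≠i} mP_j)·x ≤ D·Π_j mP_j`. -/
theorem sum_prod_erase_mul_le {Lc : ℕ} (z : Fin D → ℤ) {x : ℝ} (hx : ∀ i, x ≤ mP Lc (z i)) :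
    (∑ i, ∏ j ∈ Finset.univ.erase i, mP Lc (z j)) * x ≤ D * ∏ j, mP Lc (z j) := by
  rw [Finset.sum_mul]
  calc ∑ i, (∏ j ∈ Finset.univ.erase i, mP Lc (z j)) * x ≤ ∑ _i : Fin D, ∏ j, mP Lc (z j) :=
        Finset.sum_le_sum fun i _ => prod_erase_mul_le z i (hx i)
    _ = D * ∏ j, mP Lc (z j) := by rw [Finset.sum_const, Finset.card_univ, Fintype.card_fin, nsmul_eq_mul]

/-- [folklore] THE SCALED INVERSE SYMBOL AT TWO LEVELS: at a label of the level-`N` box (`N ≤ N′`), both `symN_N`, `symN_{N′}` are positive,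
both inverses are `≤ (π²/4)/|Q|²`, and `|symN_{N′}⁻¹ − symN_N⁻¹| ≤ (π²/24)/N²`. -/
theorem symN_two_level {N N' : ℕ} [NeZero N] [NeZero N'] (hNN' : N ≤ N') {q : Fin D → ℝ} (hq : ∀ i, |q i| ≤ π) (hq0 : q ≠ 0)
    {z : Fin D → ℤ} (hz : z ∈ boxZ N q) :
    0 < symN N (qv q z) ∧ 0 < symN N' (qv q z) ∧ (symN N (qv q z))⁻¹ ≤ π ^ 2 / 4 * (momSq (qv q z))⁻¹ ∧
      (symN N' (qv q z))⁻¹ ≤ π ^ 2 / 4 * (momSq (qv q z))⁻¹ ∧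
      |(symN N' (qv q z))⁻¹ - (symN N (qv q z))⁻¹| ≤ π ^ 2 / 24 / (N : ℝ) ^ 2 := by
  have hN : 0 < N := Nat.pos_of_ne_zero (NeZero.ne N)
  have hN' : 0 < N' := Nat.pos_of_ne_zero (NeZero.ne N')
  have hNr : (0 : ℝ) < N := by exact_mod_cast hN
  have hN'r : (0 : ℝ) < N' := by exact_mod_cast hN'
  have hNN'r : (N : ℝ) ≤ N' := by exact_mod_cast hNN'
  have hz' : z ∈ boxZ N' q := boxZ_subset hq hNN' hz
  obtain ⟨hS, hSinv⟩ := symN_label_bounds hq hq0 hz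
  obtain ⟨hS', hS'inv⟩ := symN_label_bounds hq hq0 hz'
  refine ⟨hS, hS', hSinv, hS'inv, ?_⟩
  have hQ : ∀ i, |qv q z i| ≤ π * N := abs_qv_le_of_mem_boxZ hq hz
  have hQ' : ∀ i, |qv q z i| ≤ π * N' := abs_qv_le_of_mem_boxZ hq hz'
  have hpos : 0 < momSq (qv q z) := momSq_qv_pos hq hq0 z
  have h := ReadingWeightRates.abs_inv_lat_sub_inv_lat_le hNr hN'r hQ hQ' hpos
  have e1 : symN N (qv q z) = ∑ κ, (N : ℝ) ^ 2 * (4 * Real.sin (qv q z κ / (2 * N)) ^ 2) := rfl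
  have e2 : symN N' (qv q z) = ∑ κ, (N' : ℝ) ^ 2 * (4 * Real.sin (qv q z κ / (2 * N')) ^ 2) := rfl
  rw [abs_sub_comm, e1, e2]
  refine h.trans ?_
  have hmono : 1 / (N' : ℝ) ^ 2 ≤ 1 / (N : ℝ) ^ 2 :=
    div_le_div_of_nonneg_left zero_le_one (by positivity) (pow_le_pow_left₀ hNr.le hNN'r 2)
  have hπ := Real.pi_pos
  calc π ^ 2 / 48 * (1 / (N : ℝ) ^ 2 + 1 / (N' : ℝ) ^ 2) ≤ π ^ 2 / 48 * (1 / (N : ℝ) ^ 2 + 1 / (N : ℝ) ^ 2) := by gcongr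
    _ = π ^ 2 / 24 / (N : ℝ) ^ 2 := by ring

/-- [folklore] The SQUARED inverse symbol rate: `|symN_{N′}⁻² − symN_N⁻²| ≤ (π⁴/48)/N² · |Q|⁻²` (`a² − b² = (a − b)(a + b)`). -/
theorem abs_inv_symN_sq_sub_le {N N' : ℕ} [NeZero N] [NeZero N'] (hNN' : N ≤ N') {q : Fin D → ℝ} (hq : ∀ i, |q i| ≤ π)
    (hq0 : q ≠ 0) {z : Fin D → ℤ} (hz : z ∈ boxZ N q) :
    |(symN N' (qv q z))⁻¹ ^ 2 - (symN N (qv q z))⁻¹ ^ 2| ≤ π ^ 4 / 48 / (N : ℝ) ^ 2 * (momSq (qv q z))⁻¹ := by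
  obtain ⟨hS, hS', hSinv, hS'inv, hrate⟩ := symN_two_level hNN' hq hq0 hz
  have hπ := Real.pi_pos
  have e : (symN N' (qv q z))⁻¹ ^ 2 - (symN N (qv q z))⁻¹ ^ 2
      = ((symN N' (qv q z))⁻¹ - (symN N (qv q z))⁻¹) * ((symN N' (qv q z))⁻¹ + (symN N (qv q z))⁻¹) := by ring
  rw [e, abs_mul, abs_of_pos (add_pos (inv_pos.2 hS') (inv_pos.2 hS))]
  calc |(symN N' (qv q z))⁻¹ - (symN N (qv q z))⁻¹| * ((symN N' (qv q z))⁻¹ + (symN N (qv q z))⁻¹)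
      ≤ π ^ 2 / 24 / (N : ℝ) ^ 2 * (π ^ 2 / 4 * (momSq (qv q z))⁻¹ + π ^ 2 / 4 * (momSq (qv q z))⁻¹) :=
        mul_le_mul hrate (add_le_add hS'inv hSinv) (by positivity) (by positivity)
    _ = π ^ 4 / 48 / (N : ℝ) ^ 2 * (momSq (qv q z))⁻¹ := by ring

/-- [folklore] Off the zero alias, the squared inverse symbol borrows the decay of ANY direction: `symN_{N′}⁻² ≤ mP Lc z_i/16`. -/
theorem inv_symN_sq_le_mP {N N' Lc : ℕ} [NeZero N] [NeZero N'] (hNN' : N ≤ N') (hLc : 1 ≤ Lc) {q : Fin D → ℝ}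
    (hq : ∀ i, |q i| ≤ π) (hq0 : q ≠ 0) {z : Fin D → ℤ} (hz : z ∈ boxZ N q) (hz0 : z ≠ 0) (i : Fin D) :
    (symN N' (qv q z))⁻¹ ^ 2 ≤ mP Lc (z i) / 16 := by
  obtain ⟨-, hS', -, hS'inv, -⟩ := symN_two_level hNN' hq hq0 hz
  have hπ := Real.pi_pos
  have hm1 : (momSq (qv q z))⁻¹ ≤ (π ^ 2)⁻¹ := inv_anti₀ (by positivity) (pi_sq_le_momSq_qv hq hz0)
  have hm2 : (momSq (qv q z))⁻¹ ≤ mP Lc (z i) / π ^ 2 := inv_momSq_qv_le hLc hq hz0 i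
  have hm0 : 0 ≤ (momSq (qv q z))⁻¹ := inv_nonneg.2 (momSq_nonneg _)
  calc (symN N' (qv q z))⁻¹ ^ 2 = (symN N' (qv q z))⁻¹ * (symN N' (qv q z))⁻¹ := sq _
    _ ≤ (π ^ 2 / 4 * (momSq (qv q z))⁻¹) * (π ^ 2 / 4 * (momSq (qv q z))⁻¹) :=
        mul_le_mul hS'inv hS'inv (inv_nonneg.2 hS'.le) (by positivity)
    _ ≤ (π ^ 2 / 4 * (π ^ 2)⁻¹) * (π ^ 2 / 4 * (mP Lc (z i) / π ^ 2)) := by gcongr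
    _ = mP Lc (z i) / 16 := by field_simp; ring

/-- [folklore] Off the zero alias: `symN_X⁻² ≤ 1/16` and `symN_X⁻¹ ≤ 1/4` at both levels. -/
theorem inv_symN_le_off_zero {N N' : ℕ} [NeZero N] [NeZero N'] (hNN' : N ≤ N') {q : Fin D → ℝ} (hq : ∀ i, |q i| ≤ π)
    (hq0 : q ≠ 0) {z : Fin D → ℤ} (hz : z ∈ boxZ N q) (hz0 : z ≠ 0) :
    (symN N' (qv q z))⁻¹ ≤ 1 / 4 ∧ (symN N (qv q z))⁻¹ ≤ 1 / 4 ∧ (momSq (qv q z))⁻¹ ≤ (π ^ 2)⁻¹ := by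
  have hz' : z ∈ boxZ N' q := boxZ_subset hq hNN' hz
  have hπ := Real.pi_pos
  exact ⟨inv_symN_le_quarter hq hq0 hz' hz0, inv_symN_le_quarter hq hq0 hz hz0,
    inv_anti₀ (by positivity) (pi_sq_le_momSq_qv hq hz0)⟩

/-- [folklore] ZERO-ALIAS PAIRED-PRODUCT RATE: `‖Π_i P_{N′}(q_i) − Π_i P_N(q_i)‖ ≤ (π²/24)·|q|²/N²` (each factor `≤ 1`, each factor
rate `≤ (π²/24) q_i²/N²`). -/
theorem norm_prod_pairP_sub_le_zero {N M N' M' Lc : ℕ} (hN : 0 < N) (hM : 0 < M) (hN' : 0 < N') (hM' : 0 < M') (hLc : 0 < Lc)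
    (hNM : (N : ℝ) = M * Lc) (hN'M' : (N' : ℝ) = M' * Lc) (hNN' : N ≤ N') {q : Fin D → ℝ} (hq : ∀ i, |q i| ≤ π) :
    ‖∏ i, pairP N' M' (q i) - ∏ i, pairP N M (q i)‖ ≤ π ^ 2 / 24 * momSq q / (N : ℝ) ^ 2 := by
  classical
  have hNr : (1 : ℝ) ≤ N := by exact_mod_cast hN
  have hqN : ∀ i, |q i| ≤ π * N := fun i => (hq i).trans (by nlinarith [Real.pi_pos])
  have h := norm_prod_sub_prod_le Finset.univ (fun i => pairP N' M' (q i)) (fun i => pairP N M (q i)) (fun _ => (1 : ℝ))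
    (fun j _ => norm_pairP_le_one hN' hM' _) (fun j _ => norm_pairP_le_one hN hM _)
  refine h.trans ?_
  simp only [Finset.prod_const_one, mul_one]
  calc ∑ i, ‖pairP N' M' (q i) - pairP N M (q i)‖ ≤ ∑ i, π ^ 2 / 24 * q i ^ 2 / (N : ℝ) ^ 2 :=
        Finset.sum_le_sum fun i _ => norm_pairP_sub_le_sq hN hM hN' hM' hLc hNM hN'M' hNN' (hqN i)
    _ = π ^ 2 / 24 * momSq q / (N : ℝ) ^ 2 := by
        unfold momSq; rw [Finset.mul_sum, Finset.sum_div]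

/-! ## §2 The `S_c` label model: matched rate and tail -/

section LabelsC

variable {N M N' M' Lc : ℕ} [NeZero N] [NeZero M] [NeZero N'] [NeZero M'] [NeZero Lc]

omit [NeZero N] [NeZero M] [NeZero Lc] in
/-- [folklore] Product form of the `S_c` label model: `termC = (−Lc·srcPh·eM) · (Π pairP · symN⁻²)`. -/
theorem termC_eq_mul (l : Fin D) (y' : Fin D → ℤ) (Q : Fin D → ℝ) :
    termC N M Lc l y' Q = (-((Lc : ℂ) * srcPh Lc y' Q * eM Lc (Q l))) *
      ((∏ i, pairP N M (Q i)) * (((symN N Q)⁻¹ ^ 2 : ℝ) : ℂ)) := by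
  unfold termC
  rw [div_eq_mul_inv, ← inv_pow]
  push_cast
  ring

/-- **MATCHED-LABEL RATE OF THE `S_c` MODEL.**  At a label `Q = q + 2πz` of the level-`N` box, two steps `N = M·Lc ≤ N′ = M′·Lc`:
`‖termC_{N′}(Q) − termC_N(Q)‖ ≤ [z = 0]·(π⁶/384 + π⁴/48)/(N²·|q|) + ((D·π²·Lc² + 2π²·Lc)/48)/N² · Π_i mP Lc z_i`.  [folklore; our proof] -/
theorem norm_termC_sub_le (hNM : N = M * Lc) (hN'M' : N' = M' * Lc) (hNN' : N ≤ N') {q : Fin D → ℝ} (hq : ∀ i, |q i| ≤ π)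
    (hq0 : q ≠ 0) (l : Fin D) (y' : Fin D → ℤ) {z : Fin D → ℤ} (hz : z ∈ boxZ N q) :
    ‖termC N' M' Lc l y' (qv q z) - termC N M Lc l y' (qv q z)‖
      ≤ (if z = 0 then (π ^ 6 / 384 + π ^ 4 / 48) / ((N : ℝ) ^ 2 * Real.sqrt (momSq q)) else 0)
        + (D * π ^ 2 * (Lc : ℝ) ^ 2 + 2 * π ^ 2 * Lc) / 48 / (N : ℝ) ^ 2 * ∏ i, mP Lc (z i) := by
  classical
  have hN : 0 < N := Nat.pos_of_ne_zero (NeZero.ne N)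
  have hM : 0 < M := Nat.pos_of_ne_zero (NeZero.ne M)
  have hN' : 0 < N' := Nat.pos_of_ne_zero (NeZero.ne N')
  have hM' : 0 < M' := Nat.pos_of_ne_zero (NeZero.ne M')
  have hLc : 0 < Lc := Nat.pos_of_ne_zero (NeZero.ne Lc)
  have hLc1 : 1 ≤ Lc := hLc
  have hLcr : (0 : ℝ) < Lc := by exact_mod_cast hLc
  have hNr : (0 : ℝ) < N := by exact_mod_cast hN
  have hNMr : (N : ℝ) = M * Lc := by exact_mod_cast hNM
  have hN'M'r : (N' : ℝ) = M' * Lc := by exact_mod_cast hN'M'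
  have hπ := Real.pi_pos
  have hQ : ∀ i, |qv q z i| ≤ π * N := abs_qv_le_of_mem_boxZ hq hz
  have hz' : z ∈ boxZ N' q := boxZ_subset hq hNN' hz
  have hQ' : ∀ i, |qv q z i| ≤ π * N' := abs_qv_le_of_mem_boxZ hq hz'
  obtain ⟨hS, hS', hSinv, hS'inv, -⟩ := symN_two_level hNN' hq hq0 hz
  have hw := abs_inv_symN_sq_sub_le hNN' hq hq0 hz
  have hmQ : 0 < momSq (qv q z) := momSq_qv_pos hq hq0 z
  have hP : ‖∏ i, pairP N M (qv q z i)‖ ≤ ∏ i, mP Lc (z i) := norm_prod_pairP_le hN hM hLc hNMr hq hQ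
  have hPm := prod_mP_nonneg Lc z
  -- the difference in product form
  rw [termC_eq_mul, termC_eq_mul, ← mul_sub, norm_mul, norm_neg, norm_mul, norm_mul, Complex.norm_natCast, norm_srcPh, mul_one]
  have hsplit := norm_mul_real_sub_le (∏ i, pairP N' M' (qv q z i)) (∏ i, pairP N M (qv q z i))
    ((symN N (qv q z))⁻¹ ^ 2) (sq_nonneg ((symN N' (qv q z))⁻¹))
  by_cases hz0 : z = 0
  · -- the zero alias: the product rate carries `|q|²`, the telescoped factor carries `|q_l|/Lc`
    subst hz0
    rw [if_pos rfl]
    have hq' : qv q (0 : Fin D → ℤ) = q := qv_zero q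
    rw [hq'] at hS hS' hSinv hS'inv hw hmQ hP hsplit ⊢
    rw [prod_mP_zero] at hP ⊢
    set m := momSq q with hm_def
    have hsq : 0 < Real.sqrt m := Real.sqrt_pos.2 hmQ
    have hE : ‖eM Lc (q l)‖ ≤ Real.sqrt m / Lc :=
      (norm_eM_le_abs hLc (q l)).trans (div_le_div_of_nonneg_right (SymbolProjector.abs_apply_le_sqrt_momSq q l) hLcr.le)
    have hA : ‖∏ i, pairP N' M' (q i) - ∏ i, pairP N M (q i)‖ ≤ π ^ 2 / 24 * m / (N : ℝ) ^ 2 :=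
      norm_prod_pairP_sub_le_zero hN hM hN' hM' hLc hNMr hN'M'r hNN' hq
    have hw' : (symN N' q)⁻¹ ^ 2 ≤ (π ^ 2 / 4 * m⁻¹) ^ 2 := pow_le_pow_left₀ (inv_nonneg.2 hS'.le) hS'inv 2
    have hin : ‖(∏ i, pairP N' M' (q i)) * ((((symN N' q)⁻¹ ^ 2 : ℝ)) : ℂ) - (∏ i, pairP N M (q i)) * ((((symN N q)⁻¹ ^ 2 : ℝ)) : ℂ)‖
        ≤ π ^ 2 / 24 * m / (N : ℝ) ^ 2 * (π ^ 2 / 4 * m⁻¹) ^ 2 + 1 * (π ^ 4 / 48 / (N : ℝ) ^ 2 * m⁻¹) := by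
      refine hsplit.trans (add_le_add ?_ ?_)
      · exact mul_le_mul hA hw' (sq_nonneg _) (by positivity)
      · exact mul_le_mul hP hw (abs_nonneg _) zero_le_one
    calc (Lc : ℝ) * ‖eM Lc (q l)‖ *
          ‖(∏ i, pairP N' M' (q i)) * ((((symN N' q)⁻¹ ^ 2 : ℝ)) : ℂ) - (∏ i, pairP N M (q i)) * ((((symN N q)⁻¹ ^ 2 : ℝ)) : ℂ)‖
        ≤ (Lc : ℝ) * (Real.sqrt m / Lc) *
            (π ^ 2 / 24 * m / (N : ℝ) ^ 2 * (π ^ 2 / 4 * m⁻¹) ^ 2 + 1 * (π ^ 4 / 48 / (N : ℝ) ^ 2 * m⁻¹)) := by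
          gcongr
      _ = (π ^ 6 / 384 + π ^ 4 / 48) / (N : ℝ) ^ 2 * (Real.sqrt m / m) := by field_simp; ring
      _ = (π ^ 6 / 384 + π ^ 4 / 48) / ((N : ℝ) ^ 2 * Real.sqrt m) := by
          have e : Real.sqrt m / m = 1 / Real.sqrt m := by
            rw [div_eq_div_iff hmQ.ne' hsq.ne', one_mul, Real.mul_self_sqrt hmQ.le]
          rw [e]; field_simp
      _ ≤ _ := by
          have : 0 ≤ (D * π ^ 2 * (Lc : ℝ) ^ 2 + 2 * π ^ 2 * Lc) / 48 / (N : ℝ) ^ 2 * 1 := by positivity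
          linarith
  · -- a nonzero alias: label-uniform factor rates, the decay in the differenced direction borrowed from `symN⁻²`
    rw [if_neg hz0, zero_add]
    obtain ⟨hq4', hq4, hm1⟩ := inv_symN_le_off_zero hNN' hq hq0 hz hz0
    have hE : ‖eM Lc (qv q z l)‖ ≤ 2 := norm_eM_le_two Lc _
    have hA : ‖∏ i, pairP N' M' (qv q z i) - ∏ i, pairP N M (qv q z i)‖
        ≤ π ^ 2 / 6 * Lc / (N : ℝ) ^ 2 * ∑ i, ∏ j ∈ Finset.univ.erase i, mP Lc (z j) :=
      norm_prod_pairP_sub_le hN hM hN' hM' hLc hNMr hN'M'r hNN' hq hQ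
    have hw16 : ∀ i, 16 * (symN N' (qv q z))⁻¹ ^ 2 ≤ mP Lc (z i) := fun i => by
      have := inv_symN_sq_le_mP hNN' hLc1 hq hq0 hz hz0 i; linarith
    have hborrow : (∑ i, ∏ j ∈ Finset.univ.erase i, mP Lc (z j)) * (16 * (symN N' (qv q z))⁻¹ ^ 2) ≤ D * ∏ j, mP Lc (z j) :=
      sum_prod_erase_mul_le z hw16
    have hwm : π ^ 4 / 48 / (N : ℝ) ^ 2 * (momSq (qv q z))⁻¹ ≤ π ^ 4 / 48 / (N : ℝ) ^ 2 * (π ^ 2)⁻¹ :=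
      mul_le_mul_of_nonneg_left hm1 (by positivity)
    have h1 : ‖∏ i, pairP N' M' (qv q z i) - ∏ i, pairP N M (qv q z i)‖ * (symN N' (qv q z))⁻¹ ^ 2
        ≤ π ^ 2 / 6 * Lc / (N : ℝ) ^ 2 * (D * ∏ j, mP Lc (z j)) / 16 := by
      calc ‖∏ i, pairP N' M' (qv q z i) - ∏ i, pairP N M (qv q z i)‖ * (symN N' (qv q z))⁻¹ ^ 2
          ≤ (π ^ 2 / 6 * Lc / (N : ℝ) ^ 2 * ∑ i, ∏ j ∈ Finset.univ.erase i, mP Lc (z j)) * (symN N' (qv q z))⁻¹ ^ 2 :=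
            mul_le_mul_of_nonneg_right hA (sq_nonneg _)
        _ = π ^ 2 / 6 * Lc / (N : ℝ) ^ 2 *
              ((∑ i, ∏ j ∈ Finset.univ.erase i, mP Lc (z j)) * (16 * (symN N' (qv q z))⁻¹ ^ 2)) / 16 := by ring
        _ ≤ π ^ 2 / 6 * Lc / (N : ℝ) ^ 2 * (D * ∏ j, mP Lc (z j)) / 16 := by gcongr
    have h2 : ‖∏ i, pairP N M (qv q z i)‖ * |(symN N' (qv q z))⁻¹ ^ 2 - (symN N (qv q z))⁻¹ ^ 2|
        ≤ (∏ j, mP Lc (z j)) * (π ^ 4 / 48 / (N : ℝ) ^ 2 * (π ^ 2)⁻¹) :=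
      mul_le_mul hP (hw.trans hwm) (abs_nonneg _) hPm
    calc (Lc : ℝ) * ‖eM Lc (qv q z l)‖ *
          ‖(∏ i, pairP N' M' (qv q z i)) * ((((symN N' (qv q z))⁻¹ ^ 2 : ℝ)) : ℂ)
            - (∏ i, pairP N M (qv q z i)) * ((((symN N (qv q z))⁻¹ ^ 2 : ℝ)) : ℂ)‖
        ≤ (Lc : ℝ) * 2 * (π ^ 2 / 6 * Lc / (N : ℝ) ^ 2 * (D * ∏ j, mP Lc (z j)) / 16
            + (∏ j, mP Lc (z j)) * (π ^ 4 / 48 / (N : ℝ) ^ 2 * (π ^ 2)⁻¹)) := by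
          refine mul_le_mul (mul_le_mul_of_nonneg_left hE hLcr.le) (hsplit.trans (add_le_add h1 h2)) (norm_nonneg _)
            (by positivity)
      _ = (D * π ^ 2 * (Lc : ℝ) ^ 2 + 2 * π ^ 2 * Lc) / 48 / (N : ℝ) ^ 2 * ∏ i, mP Lc (z i) := by
          field_simp; ring

/-- **TAIL BOUND OF THE `S_c` MODEL**: at a label of `boxZ N′ q` OUTSIDE the level-`N` box (`|Q|² ≥ π²N²`, leaf P1-Y11s
`sq_le_momSq_of_not_mem_boxZ`), `‖termC_{N′}(Q)‖ ≤ (Lc/8)/N² · Π_i mP Lc z_i`.  [folklore; our proof] -/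
theorem norm_termC_tail_le (hN'M' : N' = M' * Lc) {q : Fin D → ℝ} (hq : ∀ i, |q i| ≤ π) (hq0 : q ≠ 0) (l : Fin D)
    (y' : Fin D → ℤ) {z : Fin D → ℤ} (hz' : z ∈ boxZ N' q) (hzN : z ∉ boxZ N q) :
    ‖termC N' M' Lc l y' (qv q z)‖ ≤ (Lc : ℝ) / 8 / (N : ℝ) ^ 2 * ∏ i, mP Lc (z i) := by
  have hN : 0 < N := Nat.pos_of_ne_zero (NeZero.ne N)
  have hN' : 0 < N' := Nat.pos_of_ne_zero (NeZero.ne N')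
  have hM' : 0 < M' := Nat.pos_of_ne_zero (NeZero.ne M')
  have hLc : 0 < Lc := Nat.pos_of_ne_zero (NeZero.ne Lc)
  have hLcr : (0 : ℝ) < Lc := by exact_mod_cast hLc
  have hNr : (1 : ℝ) ≤ N := by exact_mod_cast hN
  have hN'M'r : (N' : ℝ) = M' * Lc := by exact_mod_cast hN'M'
  have hπ := Real.pi_pos
  have hQ' : ∀ i, |qv q z i| ≤ π * N' := abs_qv_le_of_mem_boxZ hq hz'
  obtain ⟨hS', hS'inv⟩ := symN_label_bounds hq hq0 hz'
  have hbig : (π * N) ^ 2 ≤ momSq (qv q z) := sq_le_momSq_of_not_mem_boxZ hq hzN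
  have hmpos : 0 < momSq (qv q z) := lt_of_lt_of_le (by positivity) hbig
  have hP : ‖∏ i, pairP N' M' (qv q z i)‖ ≤ ∏ i, mP Lc (z i) := norm_prod_pairP_le hN' hM' hLc hN'M'r hq hQ'
  have hPm := prod_mP_nonneg Lc z
  have hE : ‖eM Lc (qv q z l)‖ ≤ 2 := norm_eM_le_two Lc _
  have hm : (momSq (qv q z))⁻¹ ≤ ((π * N) ^ 2)⁻¹ := inv_anti₀ (by positivity) hbig
  have hinv : (symN N' (qv q z))⁻¹ ≤ π ^ 2 / 4 * ((π * N) ^ 2)⁻¹ := hS'inv.trans (mul_le_mul_of_nonneg_left hm (by positivity))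
  have hinv2 : (symN N' (qv q z))⁻¹ ^ 2 ≤ (π ^ 2 / 4 * ((π * N) ^ 2)⁻¹) ^ 2 := pow_le_pow_left₀ (inv_nonneg.2 hS'.le) hinv 2
  rw [norm_termC_eq l y' hS']
  calc (Lc : ℝ) * ‖∏ i, pairP N' M' (qv q z i)‖ * ‖eM Lc (qv q z l)‖ * (symN N' (qv q z))⁻¹ ^ 2
      ≤ (Lc : ℝ) * (∏ i, mP Lc (z i)) * 2 * (π ^ 2 / 4 * ((π * N) ^ 2)⁻¹) ^ 2 := by gcongr
    _ = (Lc : ℝ) / 8 / (N : ℝ) ^ 2 * (∏ i, mP Lc (z i)) * (1 / (N : ℝ) ^ 2) := by field_simp; ring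
    _ ≤ (Lc : ℝ) / 8 / (N : ℝ) ^ 2 * (∏ i, mP Lc (z i)) * 1 := by
        apply mul_le_mul_of_nonneg_left _ (by positivity)
        rw [div_le_one (by positivity)]; exact one_le_pow₀ hNr
    _ = (Lc : ℝ) / 8 / (N : ℝ) ^ 2 * ∏ i, mP Lc (z i) := mul_one _

end LabelsC

/-! ## §3 The two-level rate of `S_c` -/

/-- The POLE coefficient of the `S_c` rate (order `1/|q|`): `rcPole = π⁶/384 + π⁴/48`. -/
def rcPole : ℝ := π ^ 6 / 384 + π ^ 4 / 48

/-- The `p`-free coefficient of the `S_c` rate: `rcBox D Lc = ((D·π²·Lc² + 2π²·Lc)/48 + Lc/8)·(1 + 4Lc)^D`. -/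
def rcBox (D Lc : ℕ) : ℝ := ((D * π ^ 2 * (Lc : ℝ) ^ 2 + 2 * π ^ 2 * Lc) / 48 + (Lc : ℝ) / 8) * (1 + 4 * (Lc : ℝ)) ^ D

/-- [folklore] `0 ≤ rcPole`. -/
theorem rcPole_nonneg : 0 ≤ rcPole := by unfold rcPole; positivity

/-- [folklore] `0 ≤ rcBox D Lc`. -/
theorem rcBox_nonneg (D Lc : ℕ) : 0 ≤ rcBox D Lc := by unfold rcBox; positivity

section RateC

variable {N M N' M' Lc : ℕ} [NeZero N] [NeZero M] [NeZero N'] [NeZero M'] [NeZero Lc]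

/-- **TWO-LEVEL RATE OF `S_c`** (Part B for the source-side sum `S_c` of the closed-form fibre function; the shape leaf-20-g7 asked for in
CLAIMS l.3039, unit `u(N) = N⁻³`).  For `q ∈ [−π,π]^D ∖ {0}`, `p = ofRealVec q`, two steps `N = M·Lc ≤ N′ = M′·Lc`:
`‖srcC N′ p (fhatF N′ M′ p l y′)/N′³ − srcC N p (fhatF N M p l y′)/N³‖ ≤ (rcPole/|q| + rcBox D Lc)/N²`
(matched labels over `boxZ N q ⊆ boxZ N′ q` + the tail; with `N = Lc^{j+1}` this is `c·θ^j`, `θ = Lc⁻²`).  [folklore; our proof] -/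
theorem srcC_rate (hNM : N = M * Lc) (hN'M' : N' = M' * Lc) (hNN' : N ≤ N') {q : Fin D → ℝ} (hq : ∀ i, |q i| ≤ π)
    (hq0 : q ≠ 0) (l : Fin D) (y' : Fin D → ℤ) :
    ‖srcC N' (ofRealVec q) (fhatF N' M' (ofRealVec q) l y') / (N' : ℂ) ^ 3
        - srcC N (ofRealVec q) (fhatF N M (ofRealVec q) l y') / (N : ℂ) ^ 3‖
      ≤ (rcPole / Real.sqrt (momSq q) + rcBox D Lc) / (N : ℝ) ^ 2 := by
  classical
  have hN : 0 < N := Nat.pos_of_ne_zero (NeZero.ne N)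
  have hN' : 0 < N' := Nat.pos_of_ne_zero (NeZero.ne N')
  have hNc : (N : ℂ) ^ 3 ≠ 0 := pow_ne_zero 3 (by exact_mod_cast hN.ne')
  have hN'c : (N' : ℂ) ^ 3 ≠ 0 := pow_ne_zero 3 (by exact_mod_cast hN'.ne')
  have hm : 0 < momSq q := by have h := momSq_qv_pos hq hq0 0; rwa [qv_zero] at h
  have hsq : 0 < Real.sqrt (momSq q) := Real.sqrt_pos.2 hm
  have hπ := Real.pi_pos
  have hsub := boxZ_subset hq hNN' (N := N) (N' := N')
  rw [srcC_fhatF_eq hN'M' hq hq0 l y', srcC_fhatF_eq hNM hq hq0 l y', mul_div_cancel_left₀ _ hN'c, mul_div_cancel_left₀ _ hNc,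
    ← Finset.sum_sdiff hsub, add_sub_assoc, ← Finset.sum_sub_distrib]
  -- tail
  have htail : ‖∑ z ∈ boxZ N' q \ boxZ N q, termC N' M' Lc l y' (qv q z)‖ ≤ (Lc : ℝ) / 8 / (N : ℝ) ^ 2 * (1 + 4 * (Lc : ℝ)) ^ D := by
    calc ‖∑ z ∈ boxZ N' q \ boxZ N q, termC N' M' Lc l y' (qv q z)‖
        ≤ ∑ z ∈ boxZ N' q \ boxZ N q, ‖termC N' M' Lc l y' (qv q z)‖ := norm_sum_le _ _
      _ ≤ ∑ z ∈ boxZ N' q \ boxZ N q, (Lc : ℝ) / 8 / (N : ℝ) ^ 2 * ∏ i, mP Lc (z i) :=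
          Finset.sum_le_sum fun z hz => by
            obtain ⟨hz', hzN⟩ := Finset.mem_sdiff.1 hz
            exact norm_termC_tail_le (N := N) hN'M' hq hq0 l y' hz' hzN
      _ ≤ ∑ z ∈ boxZ N' q, (Lc : ℝ) / 8 / (N : ℝ) ^ 2 * ∏ i, mP Lc (z i) :=
          Finset.sum_le_sum_of_subset_of_nonneg Finset.sdiff_subset fun z _ _ => mul_nonneg (by positivity) (prod_mP_nonneg Lc z)
      _ = (Lc : ℝ) / 8 / (N : ℝ) ^ 2 * ∑ z ∈ boxZ N' q, ∏ i, mP Lc (z i) := by rw [Finset.mul_sum]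
      _ ≤ (Lc : ℝ) / 8 / (N : ℝ) ^ 2 * (1 + 4 * (Lc : ℝ)) ^ D :=
          mul_le_mul_of_nonneg_left (sum_boxZ_prod_mP_le Lc q) (by positivity)
  -- matched labels
  have hbox : ‖∑ z ∈ boxZ N q, (termC N' M' Lc l y' (qv q z) - termC N M Lc l y' (qv q z))‖
      ≤ (π ^ 6 / 384 + π ^ 4 / 48) / ((N : ℝ) ^ 2 * Real.sqrt (momSq q))
        + (D * π ^ 2 * (Lc : ℝ) ^ 2 + 2 * π ^ 2 * Lc) / 48 / (N : ℝ) ^ 2 * (1 + 4 * (Lc : ℝ)) ^ D := by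
    calc ‖∑ z ∈ boxZ N q, (termC N' M' Lc l y' (qv q z) - termC N M Lc l y' (qv q z))‖
        ≤ ∑ z ∈ boxZ N q, ‖termC N' M' Lc l y' (qv q z) - termC N M Lc l y' (qv q z)‖ := norm_sum_le _ _
      _ ≤ ∑ z ∈ boxZ N q, ((if z = 0 then (π ^ 6 / 384 + π ^ 4 / 48) / ((N : ℝ) ^ 2 * Real.sqrt (momSq q)) else 0)
            + (D * π ^ 2 * (Lc : ℝ) ^ 2 + 2 * π ^ 2 * Lc) / 48 / (N : ℝ) ^ 2 * ∏ i, mP Lc (z i)) :=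
          Finset.sum_le_sum fun z hz => norm_termC_sub_le hNM hN'M' hNN' hq hq0 l y' hz
      _ = (∑ z ∈ boxZ N q, (if z = 0 then (π ^ 6 / 384 + π ^ 4 / 48) / ((N : ℝ) ^ 2 * Real.sqrt (momSq q)) else 0))
            + (D * π ^ 2 * (Lc : ℝ) ^ 2 + 2 * π ^ 2 * Lc) / 48 / (N : ℝ) ^ 2 * ∑ z ∈ boxZ N q, ∏ i, mP Lc (z i) := by
          rw [Finset.sum_add_distrib, Finset.mul_sum]
      _ ≤ _ := add_le_add (sum_boxZ_ite_le q (by positivity))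
            (mul_le_mul_of_nonneg_left (sum_boxZ_prod_mP_le Lc q) (by positivity))
  have e : (rcPole / Real.sqrt (momSq q) + rcBox D Lc) / (N : ℝ) ^ 2
      = (Lc : ℝ) / 8 / (N : ℝ) ^ 2 * (1 + 4 * (Lc : ℝ)) ^ D
        + ((π ^ 6 / 384 + π ^ 4 / 48) / ((N : ℝ) ^ 2 * Real.sqrt (momSq q))
          + (D * π ^ 2 * (Lc : ℝ) ^ 2 + 2 * π ^ 2 * Lc) / 48 / (N : ℝ) ^ 2 * (1 + 4 * (Lc : ℝ)) ^ D) := by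
    unfold rcPole rcBox; field_simp; ring
  rw [e]
  exact (norm_add_le _ _).trans (add_le_add htail hbox)

end RateC

end Summit.QuantumFields.BalabanUV.Beta.GAN24.SourceSideRate

end
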